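import Mathlib

/-!
# Sketch — crux-ideate r2 k5, crux `TwinSimilitudeAlgebraic` (stmt-HodgeConjecture-13674)

First lemmas of the idea `doubled-graph-lagrangian-smoothing` (linear algebra only):

* `ballast_bookkeeping` — the class identity behind the anchor configuration
  `Z₀ = 2Γ + Σ_j R_j × N_j + C × D′ (+ P + …)`: with `G = [Γ]_*`, `Ψ = G − ½ Σ_j r_j ⊗ ν_j`
  (the completed Nikulin 2-similitude, `ν_j = (N_j . –)`), `[R_j] = −r_j + a_j h`,
  `[D′] = b h′ − Σ a_j N_j` (so `[D′]^∨ = b η − Σ a_j ν_j`, `η = (h′ . –)`), the induced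
  correspondence of `Z₀` is `2Ψ + b · h ⊗ η` — the route's class `2·graph Ψ` plus a ballast
  whose Hodge locus is the whole polarised twin locus.
* `leakage_criterion` — Voisin's criterion in leakage form: for a pull-back `f : V′ → W` with
  adjoint (push-forward) `g : W → V′` and an "exceptional" subspace `E ⊆ W`,
  `f y ⊥ E ↔ y ⊥ g(E)`; i.e. the Lagrangian/Hodge locus of an effective Lagrangian
  correspondence is cut out by the LEAKAGE lattice `K′ = g(E) = j₂_*(ker j₁_*)`.
-/

set_option linter.dupNamespace false

namespace Summit.HodgeConjecture.HodgeConjecture.Cruxes.TwinSimilitudeAlgebraic.IdeaSketch5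

open LinearMap

section Ballast

variable {R V V' ι : Type*} [Field R] [AddCommGroup V] [Module R V]
  [AddCommGroup V'] [Module R V'] [Fintype ι]

/-- Rank-one correspondence `x ⊗ φ : y ↦ φ(y) • x`. -/
abbrev rk1 (x : V) (φ : V' →ₗ[R] R) : V' →ₗ[R] V := φ.smulRight x

theorem rk1_apply (x : V) (φ : V' →ₗ[R] R) (y : V') : rk1 x φ y = φ y • x := rfl

/-- **Ballast bookkeeping.** `2G + Σ_j (−r_j + a_j h) ⊗ ν_j + h ⊗ (b η − Σ_j a_j ν_j)
 = 2 (G − ½ Σ_j r_j ⊗ ν_j) + b (h ⊗ η)`. -/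
theorem ballast_bookkeeping (hR : (2 : R) ≠ 0) (G : V' →ₗ[R] V) (h : V) (η : V' →ₗ[R] R)
    (r : ι → V) (ν : ι → (V' →ₗ[R] R)) (a : ι → R) (b : R) :
    (2 : R) • G + ∑ j, rk1 (-(r j) + a j • h) (ν j) + rk1 h (b • η - ∑ j, a j • ν j)
      = (2 : R) • (G - (2 : R)⁻¹ • ∑ j, rk1 (r j) (ν j)) + b • rk1 h η := by
  ext y
  have h2 : (2 : R) * (2 : R)⁻¹ = 1 := mul_inv_cancel₀ hR
  simp only [LinearMap.add_apply, LinearMap.smul_apply, LinearMap.sub_apply,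
    LinearMap.coe_sum, Finset.sum_apply, rk1_apply, smul_add, smul_neg, sub_smul,
    Finset.sum_smul, smul_sub, Finset.smul_sum, smul_smul, Finset.sum_add_distrib,
    Finset.sum_neg_distrib, smul_eq_mul, h2, one_mul]
  simp only [mul_comm (a _) ((ν _) y)]
  abel

end Ballast

section Leakage

variable {R V' W : Type*} [CommRing R] [AddCommGroup V'] [Module R V'] [AddCommGroup W] [Module R W]

/-- **Leakage criterion (Voisin's condition in lattice form).** Let `B` (on `W = H²(Z̃)`) and
`B′` (on `V′ = H²(S′)`) be bilinear forms, `f = j₂^*` a pull-back and `g = j₂_*` its adjoint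
(projection formula `B (f y) w = B′ y (g w)`). For a subspace `E ⊆ W` (the classes killed by
`j₁_*`, e.g. the exceptional curves of a graph closure) one has
`f y ∈ E^⊥  ↔  y ∈ (g E)^⊥`: the pull-back of `y` lands in `j₁^* H²(S) = E^⊥` exactly when `y`
is orthogonal to the leakage lattice `K′ = g(E)`. -/
theorem leakage_criterion (B : W →ₗ[R] W →ₗ[R] R) (B' : V' →ₗ[R] V' →ₗ[R] R)
    (f : V' →ₗ[R] W) (g : W →ₗ[R] V') (hadj : ∀ y w, B (f y) w = B' y (g w))
    (E : Submodule R W) (y : V') :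
    (∀ e ∈ E, B (f y) e = 0) ↔ (∀ k ∈ E.map g, B' y k = 0) := by
  constructor
  · rintro hy k ⟨e, he, rfl⟩
    rw [← hadj]
    exact hy e he
  · intro hy e he
    rw [hadj]
    exact hy (g e) ⟨e, he, rfl⟩

/-- Consequence used for the dimension count `dim M_Z = 20 − ℓ`: the propagation locus of the
Lagrangian correspondence is `{σ′ ⊥ K′}` with `K′ = g(E)`; if `K′ = 0` (no leakage) every
period qualifies. -/
theorem leakage_zero (B : W →ₗ[R] W →ₗ[R] R) (B' : V' →ₗ[R] V' →ₗ[R] R)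
    (f : V' →ₗ[R] W) (g : W →ₗ[R] V') (hadj : ∀ y w, B (f y) w = B' y (g w))
    (E : Submodule R W) (hK : E.map g = ⊥) (y : V') : ∀ e ∈ E, B (f y) e = 0 := by
  rw [leakage_criterion B B' f g hadj E y, hK]
  intro k hk
  rw [Submodule.mem_bot] at hk
  simp [hk]

end Leakage

end Summit.HodgeConjecture.HodgeConjecture.Cruxes.TwinSimilitudeAlgebraic.IdeaSketch5
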